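import Mathlib
import HarnessLib
import Summits.NavierStokesRegularity.NavierStokesRegularity.Theorems.TypeIQuarterGateScarEnvelopeTypeIForcedTsaiAlgCert

/-!
# ARM B lane E-exact, Type-I-tail class — rows with a CERTIFIED POLYNOMIAL LEVEL FLOOR (`AlgRowF`, LANEX-ALG v2)

The structural floor `φ = (1 − (t/100)^m)(1 − (1−v²)^k)^m` of `…ForcedTsaiAlgCert` loses 6–9 % of the level of a
Type-I-tail witness (its enstrophy tail on `ρ ∈ [5,10]` and beyond).  This module lets a row carry an arbitrary
polynomial floor `φ(y) = P(W(y))`, `W = v² = (1+|y|²/τ²)^{−1} ∈ (0,1]`, `P(W) = Σ_k p_k W^k` (`p_k ∈ ℚ`), together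
with an exact CERTIFICATE that `P ≤ 𝟙_{[W₁₀,1]}` on `[0,1]` (`W₁₀ = τ²/(τ²+100)`, i.e. `φ ≤ 𝟙_{B₁₀}`): two partitions
`cuts0` of `[0,W₁₀]` and `cuts1` of `[W₁₀,1]`, and on every piece `[a,a+h]` the Taylor-shift bound
`P ≤ d₀ + Σ_{k≥1} max(d_k,0)·h^k`, `d_k = Σ_j p_j C(j,k) a^{j−k}` (exact rationals) must be `≤ 0` resp. `≤ 1`.
`AlgRowF.checkF` = the v1 check with this floor in the level integrand.  Soundness (`AlgRowF.sound`) is in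
`…ForcedTsaiAlgSoundF`.  Mirror: `pub-ns-dss/wall-extremal/arm-B/alg/floor_cert.py` / `algcert.py`.
Effect (producer numbers): floor efficiency 0.94 → 0.98 at level 16, 0.91 → 0.97 at level ¼.
HONEST FRAMING: certificate format; UPPER bounds on the forced-Tsai modulus only; nothing about NS regularity.
-/

set_option linter.dupNamespace false

namespace Summit.NavierStokesRegularity.NavierStokesRegularity.Cruxes.ScarEnvelopeTypeI.ForcedTsai

open Finset

/-- A certified polynomial level floor: power-basis coefficients `p` of `P(W) = Σ_k p_k W^k` and the two partitions. -/
structure FloorCert where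
  /-- coefficients `p₀, p₁, …` of `P` in powers of `W = v²` -/ p : List ℚ
  /-- partition points of `[0, W₁₀]` (first `0`, last `W₁₀`) -/ cuts0 : List ℚ
  /-- partition points of `[W₁₀, 1]` (first `W₁₀`, last `1`) -/ cuts1 : List ℚ

namespace FloorCert

/-- `W₁₀ = τ²/(τ²+100)`, the value of `W` on the sphere `|y| = 10`. -/
def W10 (τ : ℚ) : ℚ := τ * τ / (τ * τ + 100)

/-- Coefficient `j` of `p` (zero beyond the end). -/
def coeff (p : List ℚ) (j : ℕ) : ℚ := p.getD j 0

/-- `P(w) = Σ_{j<n} p_j w^j` (rational evaluation). -/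
def evalQ (p : List ℚ) (w : ℚ) : ℚ := ∑ j ∈ range p.length, coeff p j * w ^ j

/-- Taylor coefficient at `a`: `d_k = Σ_{j ≥ k} p_j·C(j,k)·a^{j−k}`. -/
def taylorCoeff (p : List ℚ) (a : ℚ) (k : ℕ) : ℚ :=
  ∑ j ∈ range p.length, if k ≤ j then coeff p j * (Nat.choose j k : ℚ) * a ^ (j - k) else 0

/-- Certified upper bound of `P` on `[a, a+h]` (`h ≥ 0`): `d₀ + Σ_{k≥1} max(d_k, 0)·h^k`. -/
def upperOn (p : List ℚ) (a h : ℚ) : ℚ :=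
  ∑ k ∈ range p.length, if k = 0 then taylorCoeff p a 0 else max (taylorCoeff p a k) 0 * h ^ k

/-- Every consecutive piece `[a,b]` of the list has `a ≤ b` and certified bound `≤ bound`; a singleton checks the point. -/
def piecesOK (p : List ℚ) (bound : ℚ) : List ℚ → Bool
  | [] => true
  | [a] => decide (upperOn p a 0 ≤ bound)
  | a :: b :: rest => decide (a ≤ b) && decide (upperOn p a (b - a) ≤ bound) && piecesOK p bound (b :: rest)

/-- The certificate check: `cuts0` runs from `0` to `W₁₀` with `P ≤ 0` on every piece, `cuts1` from `W₁₀` to `1` with `P ≤ 1`. -/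
def check (c : FloorCert) (τ : ℚ) : Bool :=
  decide (c.cuts0.head? = some 0) && decide (c.cuts0.getLast? = some (W10 τ)) &&
    decide (c.cuts1.head? = some (W10 τ)) && decide (c.cuts1.getLast? = some 1) &&
    piecesOK c.p 0 c.cuts0 && piecesOK c.p 1 c.cuts1

/-- The floor as a 5-polynomial: `Σ_k p_k v^{2k}`. -/
def poly (c : FloorCert) : Poly5 := (List.range c.p.length).map fun k => ⟨0, 0, 0, 0, 2 * k, coeff c.p k⟩

end FloorCert

/-- A Type-I-tail witness row with a CERTIFIED POLYNOMIAL FLOOR (v2): as `AlgRow` but `floor : FloorCert` replaces `(mF, kF)`. -/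
structure AlgRowF where
  /-- kernel scale `τ` -/ tau : ℚ
  /-- the three components of the symbolic vector potential `Ψ` -/ psi : Fin 3 → Poly5
  /-- the certified polynomial level floor -/ floor : FloorCert
  /-- AM-GM radius for `ρ¹` -/ r1 : ℚ
  /-- AM-GM radius for `ρ³` -/ r3 : ℚ
  /-- AM-GM radius for `ρ⁵` -/ r5 : ℚ
  /-- claimed level floor -/ M : ℚ
  /-- claimed residual ceiling -/ δ : ℚ

namespace AlgRowF

/-- The underlying v1 row (floor parameters unused). -/
def toRow (r : AlgRowF) : AlgRow := ⟨r.tau, r.psi, 0, 0, r.r1, r.r3, r.r5, r.M, r.δ⟩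

/-- Level integrand with the certified floor: `P(W)·|ω|²`. -/
def levPolyF (r : AlgRowF) : Poly5 :=
  Poly5.nmul r.floor.poly
    (Poly5.add (Poly5.add (Poly5.nmul (r.toRow.om 0) (r.toRow.om 0)) (Poly5.nmul (r.toRow.om 1) (r.toRow.om 1)))
      (Poly5.nmul (r.toRow.om 2) (r.toRow.om 2)))

/-- `lev2F = ∫ P(W)|ω|²` as `(c₁, c₂)` (or `none`). -/
def lev2F (r : AlgRowF) : Option (ℚ × ℚ) := Poly5.integrate r.tau r.levPolyF

/-- **The total Boolean check of a v2 row** (exact rational arithmetic). -/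
def checkF (r : AlgRowF) : Bool :=
  decide (0 < r.tau) && decide (0 < r.r1) && decide (0 < r.r3) && decide (0 < r.r5) &&
    decide (0 ≤ r.M) && decide (0 ≤ r.δ) && r.floor.check r.tau &&
    (match r.lev2F, r.toRow.res2 with
      | some L, some R => decide (r.M * r.M ≤ encLo L) && decide (encHi R ≤ r.δ * r.δ)
      | _, _ => false)

end AlgRowF

end Summit.NavierStokesRegularity.NavierStokesRegularity.Cruxes.ScarEnvelopeTypeI.ForcedTsai
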